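import Literature.RingTheory.FormalGroups.TypicalLogarithm
import Mathlib.RingTheory.MvPowerSeries.Expand
import HarnessLib

/-!
# The functional-equation identity for Hazewinkel's `p`-typical logarithm `f_V`
# ([Hazewinkel 1978] §2.2–§2.4, functional-equation lemma, the computation behind parts (i) and (iii))

Topic `Literature/RingTheory/FormalGroups`; namespace `Literature.RingTheory.FormalGroups`.  THEOREMS ONLY; no definition,
no named fact, no instance, no `sorry`.  Sequel of `TypicalLogarithm.lean` (`typLogCoeff p n = a_n(V)`,
`typLog p = f_V = Σ a_n X^{pⁿ}` over `K = ℚ[V]`, `V_{i+1} = X i`, `σ^j = expand (p^j)`).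

For a multivariate series `P ∈ K⟦X_τ⟧` without constant term put `W_j(P) = σ^j_* P (X^{p^j})` (apply `σ^j` to the coefficients,
raise the variables to the `p^j`-th power — Mathlib `MvPowerSeries.expand`) and `f^{(j)} = σ^j_* f_V`.  Hazewinkel's
functional-equation expression is `E(P) = f_V(P) - Σ_{i ≥ 0} (X_i/p) · f^{(i+1)}(W_{i+1}(P))`.  Coefficientwise, with
`D = |d|` (all sums are finite):

* `coeff_typLogFE_eq` — **the identity**
  `[X^d] f_V(P) - Σ_{i<D} X_i p⁻¹ [X^d] f^{(i+1)}(W_{i+1}P) = [X^d] P + Σ_{i<D} Σ_{m<D-i} X_i p⁻¹ σ^{i+1}(a_m) [X^d]((P^{p^{i+1}})^{p^m} - (W_{i+1}P)^{p^m})`,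
  obtained by substituting the recursion `p a_{n+1} = Σ_i X_i σ^{i+1}(a_{n-i})` into `f_V(P) = Σ_n a_n P^{pⁿ}`;
* `coeff_typLogFE_X` — **the functional equation of `f_V` itself**: for `P = X_t` all correction terms vanish
  (`W_j(X_t) = X_t^{p^j}`), so `[X^d] f_V(X_t) - Σ_{i<D} X_i p⁻¹ [X^d] f^{(i+1)}(X_t^{p^{i+1}}) = [X^d] X_t`.

The integrality consequence (each correction term is integral when `P` is, since `W_j(P) ≡ P^{p^j} (mod p)`) and the
universal `p`-typical law are in `UniversalTypicalLaw.lean`.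

## References
* [Hazewinkel1978] M. Hazewinkel, *Formal Groups and Applications* (1978), §2.2 (functional-equation lemma 2.2.1–2.2.3),
  §2.4 (its proof, (2.4.4)–(2.4.9)), §15.2 (`F_V`).
-/

noncomputable section

namespace Literature.RingTheory.FormalGroups

open MvPolynomial Finset

variable (p : ℕ) [hp : Fact p.Prime]

/-! ## §1 Finite-sum bookkeeping -/

omit hp in
/-- Triangular reindexing `Σ_{n<D} Σ_{i≤n} g(i, n-i) = Σ_{i<D} Σ_{m<D-i} g(i,m)`. [folklore] -/
private theorem sum_range_triangle {α : Type*} [AddCommMonoid α] (g : ℕ → ℕ → α) (D : ℕ) :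
    ∑ n ∈ range D, ∑ i ∈ range (n + 1), g i (n - i) = ∑ i ∈ range D, ∑ m ∈ range (D - i), g i m := by
  induction D with
  | zero => simp
  | succ D ih =>
    rw [sum_range_succ, ih, sum_range_succ, sum_range_succ, Nat.sub_self, Nat.add_sub_cancel_left, range_one,
      sum_singleton, ← add_assoc]
    congr 1
    rw [← sum_add_distrib]
    refine sum_congr rfl fun i hi => ?_
    rw [mem_range] at hi
    rw [show D + 1 - i = (D - i) + 1 by omega, sum_range_succ]

/-! ## §2 The twisted arguments `W_j(P) = σ^j_* P(X^{p^j})` and logarithms `f^{(j)} = σ^j_* f_V` -/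

section

variable {τ : Type*}

/-- `W_j(P)` has no constant term if `P` has none. [cite: Hazewinkel1978, §2.4] -/
theorem constantCoeff_expand_map {P : MvPowerSeries τ (MvPolynomial ℕ ℚ)} (hP : MvPowerSeries.constantCoeff P = 0) (j : ℕ) :
    MvPowerSeries.constantCoeff (MvPowerSeries.expand (p ^ j) (pow_ne_zero j hp.out.ne_zero)
      (MvPowerSeries.map (MvPolynomial.expand (p ^ j) : MvPolynomial ℕ ℚ →ₐ[ℚ] MvPolynomial ℕ ℚ).toRingHom P)) = 0 := by
  rw [MvPowerSeries.constantCoeff_expand, MvPowerSeries.constantCoeff_map, hP, map_zero]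

/-- `W_j(P)` has order `≥ p^j`. [cite: Hazewinkel1978, §2.4] -/
theorem pow_le_order_expand_map {P : MvPowerSeries τ (MvPolynomial ℕ ℚ)} (hP : MvPowerSeries.constantCoeff P = 0) (j : ℕ) :
    ((p ^ j : ℕ) : ℕ∞) ≤ (MvPowerSeries.expand (p ^ j) (pow_ne_zero j hp.out.ne_zero)
      (MvPowerSeries.map (MvPolynomial.expand (p ^ j) : MvPolynomial ℕ ℚ →ₐ[ℚ] MvPolynomial ℕ ℚ).toRingHom P)).order := by
  rw [MvPowerSeries.order_expand]
  have h1 : ((1 : ℕ) : ℕ∞) ≤ (MvPowerSeries.map (MvPolynomial.expand (p ^ j) : MvPolynomial ℕ ℚ →ₐ[ℚ] MvPolynomial ℕ ℚ).toRingHom P).order :=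
    one_le_order_of_constantCoeff (by rw [MvPowerSeries.constantCoeff_map, hP, map_zero])
  calc ((p ^ j : ℕ) : ℕ∞) = (p ^ j) • ((1 : ℕ) : ℕ∞) := by simp
    _ ≤ (p ^ j) • _ := nsmul_le_nsmul_right h1 _

/-- The coefficients of `f^{(j)} = σ^j_* f_V`: `σ^j(a_n)` at `X^{pⁿ}`, zero elsewhere. [cite: Hazewinkel1978, §2.4] -/
theorem coeff_map_expand_typLog (j n : ℕ) :
    PowerSeries.coeff (p ^ n) (PowerSeries.map (MvPolynomial.expand (p ^ j) : MvPolynomial ℕ ℚ →ₐ[ℚ] MvPolynomial ℕ ℚ).toRingHom (typLog p)) =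
      MvPolynomial.expand (p ^ j) (typLogCoeff p n) := by
  rw [PowerSeries.coeff_map, coeff_typLog_pow]; rfl

omit hp in
/-- `f^{(j)}` is supported on the exponents `pⁿ`. [cite: Hazewinkel1978, §2.4] -/
theorem coeff_map_expand_typLog_of_ne_pow (j : ℕ) {m : ℕ} (h : ∀ n, m ≠ p ^ n) :
    PowerSeries.coeff m (PowerSeries.map (MvPolynomial.expand (p ^ j) : MvPolynomial ℕ ℚ →ₐ[ℚ] MvPolynomial ℕ ℚ).toRingHom (typLog p)) = 0 := by
  rw [PowerSeries.coeff_map, coeff_typLog_of_ne_pow p h, map_zero]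

/-! ## §3 The functional-equation identity -/

/-- **The functional-equation identity for `f_V`** (Hazewinkel's computation (2.4.4)–(2.4.9) for the `p`-typical functional
equation `f_V = X + Σ_i (V_i/p) σ^i_* f_V(X^{p^i})`): for `P` without constant term and `D = |d|`,
`[X^d] f_V(P) - Σ_{i<D} X_i p⁻¹ [X^d] f^{(i+1)}(W_{i+1}P) = [X^d]P + Σ_{i<D} Σ_{m<D-i} X_i p⁻¹ σ^{i+1}(a_m) · [X^d]((P^{p^{i+1}})^{p^m} - (W_{i+1}P)^{p^m})`.
[cite: Hazewinkel1978, §2.4 (2.4.4)–(2.4.9)] -/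
theorem coeff_typLogFE_eq {P : MvPowerSeries τ (MvPolynomial ℕ ℚ)} (hP : MvPowerSeries.constantCoeff P = 0) (d : τ →₀ ℕ) :
    MvPowerSeries.coeff d (PowerSeries.subst P (typLog p)) -
      ∑ i ∈ range d.degree, X i * MvPolynomial.C (p : ℚ)⁻¹ *
        MvPowerSeries.coeff d (PowerSeries.subst
          (MvPowerSeries.expand (p ^ (i + 1)) (pow_ne_zero _ hp.out.ne_zero)
            (MvPowerSeries.map (MvPolynomial.expand (p ^ (i + 1)) : MvPolynomial ℕ ℚ →ₐ[ℚ] MvPolynomial ℕ ℚ).toRingHom P))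
          (PowerSeries.map (MvPolynomial.expand (p ^ (i + 1)) : MvPolynomial ℕ ℚ →ₐ[ℚ] MvPolynomial ℕ ℚ).toRingHom (typLog p))) =
    MvPowerSeries.coeff d P +
      ∑ i ∈ range d.degree, ∑ m ∈ range (d.degree - i), X i * MvPolynomial.C (p : ℚ)⁻¹ *
        MvPolynomial.expand (p ^ (i + 1)) (typLogCoeff p m) *
        MvPowerSeries.coeff d ((P ^ p ^ (i + 1)) ^ p ^ m -
          (MvPowerSeries.expand (p ^ (i + 1)) (pow_ne_zero _ hp.out.ne_zero)
            (MvPowerSeries.map (MvPolynomial.expand (p ^ (i + 1)) : MvPolynomial ℕ ℚ →ₐ[ℚ] MvPolynomial ℕ ℚ).toRingHom P)) ^ p ^ m) := by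
  set D := d.degree with hD
  set σ : ℕ → (MvPolynomial ℕ ℚ →ₐ[ℚ] MvPolynomial ℕ ℚ) := fun j => MvPolynomial.expand (p ^ j) with hσ
  set W : ℕ → MvPowerSeries τ (MvPolynomial ℕ ℚ) := fun j =>
    MvPowerSeries.expand (p ^ j) (pow_ne_zero _ hp.out.ne_zero) (MvPowerSeries.map (σ j).toRingHom P) with hW
  -- `[X^d] f_V(P) = a_0 [P]_d + Σ_{n<D} a_{n+1} [P^{p^{n+1}}]_d`
  have h1 : MvPowerSeries.coeff d (PowerSeries.subst P (typLog p)) =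
      MvPowerSeries.coeff d P + ∑ n ∈ range D, typLogCoeff p (n + 1) * MvPowerSeries.coeff d (P ^ p ^ (n + 1)) := by
    rw [coeff_psubst_eq_sum_of_pow_support p hp.out (fun m hm => coeff_typLog_of_ne_pow p hm) hP d, sum_range_succ']
    simp only [coeff_typLog_pow, pow_zero, pow_one, coeff_one_typLog, one_mul]
    rw [add_comm]
  -- substitute the recursion and reindex
  have h2 : ∑ n ∈ range D, typLogCoeff p (n + 1) * MvPowerSeries.coeff d (P ^ p ^ (n + 1)) =
      ∑ i ∈ range D, ∑ m ∈ range (D - i), X i * MvPolynomial.C (p : ℚ)⁻¹ * σ (i + 1) (typLogCoeff p m) *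
        MvPowerSeries.coeff d ((P ^ p ^ (i + 1)) ^ p ^ m) := by
    rw [← sum_range_triangle (fun i m => X i * MvPolynomial.C (p : ℚ)⁻¹ * σ (i + 1) (typLogCoeff p m) *
        MvPowerSeries.coeff d ((P ^ p ^ (i + 1)) ^ p ^ m)) D]
    refine sum_congr rfl fun n hn => ?_
    rw [typLogCoeff_succ, Finset.smul_sum, Finset.sum_mul]
    refine sum_congr rfl fun i hi => ?_
    rw [mem_range] at hi
    rw [← pow_mul, ← pow_add, show i + 1 + (n - i) = n + 1 by omega, Algebra.smul_def, MvPolynomial.algebraMap_eq]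
    ring
  -- `[X^d] f^{(i+1)}(W_{i+1}) = Σ_{m<D-i} σ^{i+1}(a_m) [W^{p^m}]_d`
  have h3 : ∀ i ∈ range D, MvPowerSeries.coeff d (PowerSeries.subst (W (i + 1)) (PowerSeries.map (σ (i + 1)).toRingHom (typLog p))) =
      ∑ m ∈ range (D - i), σ (i + 1) (typLogCoeff p m) * MvPowerSeries.coeff d (W (i + 1) ^ p ^ m) := by
    intro i hi
    rw [mem_range] at hi
    rw [coeff_psubst_eq_sum_of_pow_support p hp.out (fun m hm => coeff_map_expand_typLog_of_ne_pow p _ hm)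
      (constantCoeff_expand_map p hP _) d]
    rw [← Finset.sum_subset (range_subset_range.2 (show D - i ≤ D + 1 by omega))]
    · refine sum_congr rfl fun m _ => ?_
      rw [coeff_map_expand_typLog]
    · intro m hm hm'
      rw [mem_range] at hm hm'
      rw [MvPowerSeries.coeff_of_lt_order, mul_zero]
      have hord := pow_le_order_expand_map p hP (i + 1)
      have hpow : ((p ^ (i + 1) * p ^ m : ℕ) : ℕ∞) ≤ (W (i + 1) ^ p ^ m).order := by
        refine le_trans ?_ (le_trans (nsmul_le_nsmul_right hord (p ^ m)) (MvPowerSeries.le_order_pow (p ^ m)))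
        simp [mul_comm]
      refine lt_of_lt_of_le ?_ hpow
      have : D < p ^ (i + 1) * p ^ m := by
        rw [← pow_add]
        exact lt_of_lt_of_le (by omega) (Nat.lt_pow_self hp.out.one_lt).le
      exact_mod_cast this
  rw [h1, h2, add_sub_assoc, ← Finset.sum_sub_distrib]
  congr 1
  refine sum_congr rfl fun i hi => ?_
  rw [h3 i hi, Finset.mul_sum, ← Finset.sum_sub_distrib]
  refine sum_congr rfl fun m _ => ?_
  rw [map_sub]
  ring

/-- **The functional equation of `f_V`**: `f_V(X_t) - Σ_i X_i p⁻¹ f^{(i+1)}(X_t^{p^{i+1}}) = X_t` coefficientwise — for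
`P = X_t` one has `W_j(X_t) = X_t^{p^j}` and every correction term of `coeff_typLogFE_eq` vanishes.
[cite: Hazewinkel1978, §2.2 (2.2.1), §15.2 (15.2.2)] -/
theorem coeff_typLogFE_X (t : τ) (d : τ →₀ ℕ) :
    MvPowerSeries.coeff d (PowerSeries.subst (MvPowerSeries.X t : MvPowerSeries τ (MvPolynomial ℕ ℚ)) (typLog p)) -
      ∑ i ∈ range d.degree, X i * MvPolynomial.C (p : ℚ)⁻¹ *
        MvPowerSeries.coeff d (PowerSeries.subst
          (MvPowerSeries.expand (p ^ (i + 1)) (pow_ne_zero _ hp.out.ne_zero)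
            (MvPowerSeries.map (MvPolynomial.expand (p ^ (i + 1)) : MvPolynomial ℕ ℚ →ₐ[ℚ] MvPolynomial ℕ ℚ).toRingHom
              (MvPowerSeries.X t)))
          (PowerSeries.map (MvPolynomial.expand (p ^ (i + 1)) : MvPolynomial ℕ ℚ →ₐ[ℚ] MvPolynomial ℕ ℚ).toRingHom (typLog p))) =
    MvPowerSeries.coeff d (MvPowerSeries.X t : MvPowerSeries τ (MvPolynomial ℕ ℚ)) := by
  rw [coeff_typLogFE_eq p (MvPowerSeries.constantCoeff_X t) d, add_eq_left]
  refine sum_eq_zero fun i _ => sum_eq_zero fun m _ => ?_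
  rw [MvPowerSeries.map_X, MvPowerSeries.expand_X, sub_self, map_zero, mul_zero]

end

end Literature.RingTheory.FormalGroups
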